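import Mathlib
import HarnessLib

/-!
# Lattice site polynomials: finite-dimensional graded spaces of smooth functionals on `E^Λ`

HONEST FRAMING: exact (Metropolis-corrected) sampling algorithms for lattice gauge theory;
figures of merit are autocorrelation/cost numbers at stated couplings and volumes; no
continuum-physics claim.

Venture `LatticeQCDFlow` (cell pub-lqcd), topic `Exactness`; FANOUT row 7 (`s0-cpn-null`: the
S0-D1 rung — 2D CP⁹, Lüscher's LO trivializing map inside HMC, Engel–Schaefer 2011).  NEW WORK of
the cell over Mathlib only; nothing is cited as a fact.  It is the sphere-model counterpart of the
tree's gauge-side bookkeeping `TrivializingMaps/LinkPolynomials.lean` (theory-1: link polynomials,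
`polyL`), written for the site variables of the lattice CP(N−1)/O(N) models.  Printed counterpart,
NAMED ONLY: M. Lüscher, Commun. Math. Phys. 293 (2010) 899, §4.4 ("`Δ` maps any polynomial … into
another polynomial", so each order of the flow action is obtained "by linear algebra");
Engel–Schaefer, Comput. Phys. Commun. 182 (2011) 2107, §3.

## Setting and content

`E` a finite-dimensional real inner product space with its standard orthonormal frame
`b = stdOrthonormalBasis ℝ E` (indexed by `Fin (dim E)`), `Λ` a (finite) set of sites,
configurations `x : Λ → E` — the ambient space of the product of the site spheres.

* `SiteCoord Λ E = Λ × Fin (dim E)`; `scoord (n, i) x = ⟪b i, x n⟫` — the real site coordinates;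
  `smonom κs = ∏ⱼ scoord (κs j)` — their monomials (`smonom_zero`, `smonom_succ`,
  `smonom_mul_smonom`).
* **`polyS Λ E N`** — the real span of the site monomials of degree `≤ N`: finite-dimensional
  (`polyS.finiteDimensional`), monotone in `N` (`polyS_mono`), containing the constants
  (`one_mem_polyS`, `const_mem_polyS`), the coordinates (`scoord_mem_polyS`) and every linear site
  functional `x ↦ ⟪w, x n⟫` (`slin_mem_polyS`), graded under products (`mul_mem_polyS`,
  `mul_mem_polyS_of_le`); all members are smooth (`contDiff_of_mem_polyS`).

The stability of these spaces under the site derivatives, the Euler operators and E–S's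
`Σ_k ∂̃_k·∂̃_k` (on the product of unit spheres) is the business of the sequels
`Exactness/LatticeSiteDerivatives.lean` and `Exactness/LatticeSitePolynomialLaplacian.lean`;
together they give the polynomial instance of `Exactness/SphereLatticePoissonSolver.lean` and
hence the existence of Lüscher's flow-action series at all orders for polynomial actions.

NOT CLAIMED: basis independence of `polyS` (true, not needed); anything about spheres or measures
(this file is linear algebra and smoothness only); anything quantitative.
-/

noncomputable section

namespace Summit.Ventures.LatticeQCDFlow.Exactness

open Function Set
open scoped RealInnerProductSpace ContDiff

variable {Λ : Type*} {E : Type*} [NormedAddCommGroup E] [InnerProductSpace ℝ E]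
  [FiniteDimensional ℝ E]

/-! ## §1 Site coordinates, site monomials, the spaces `polyS N` -/

section Spaces

variable (Λ E) in
/-- Index of a real coordinate of a configuration `x : Λ → E`: a site and a vector of the standard
orthonormal frame of `E`. -/
abbrev SiteCoord : Type _ := Λ × Fin (Module.finrank ℝ E)

/-- **The real site coordinate** `x ↦ ⟪b i, x n⟫` (`b` the standard orthonormal frame of `E`). -/
def scoord (κ : SiteCoord Λ E) : (Λ → E) → ℝ := fun x => ⟪stdOrthonormalBasis ℝ E κ.2, x κ.1⟫

/-- **The site monomial** `∏ⱼ scoord (κs j)` of a finite family of site coordinates. -/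
def smonom {k : ℕ} (κs : Fin k → SiteCoord Λ E) : (Λ → E) → ℝ := fun x => ∏ j, scoord (κs j) x

/-- The empty monomial is the constant `1`. -/
theorem smonom_zero (κs : Fin 0 → SiteCoord Λ E) : smonom κs = fun _ => (1 : ℝ) := by
  funext x; simp [smonom]

/-- Splitting off the first factor: `smonom κs = scoord (κs 0) · smonom (tail κs)`. -/
theorem smonom_succ {k : ℕ} (κs : Fin (k + 1) → SiteCoord Λ E) :
    smonom κs = fun x => scoord (κs 0) x * smonom (Fin.tail κs) x := by
  funext x; simp only [smonom, Fin.prod_univ_succ, Fin.tail]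

variable (Λ E) in
/-- **`polyS Λ E N`**: the real span of the site monomials of degree `≤ N` — the lattice
polynomials of degree at most `N` in the real site coordinates. -/
def polyS (N : ℕ) : Submodule ℝ ((Λ → E) → ℝ) :=
  Submodule.span ℝ (range fun p : (Σ k : Fin (N + 1), (Fin k → SiteCoord Λ E)) => smonom p.2)

/-- `polyS N` is finite-dimensional (finitely many monomials on a finite lattice). -/
instance polyS.finiteDimensional [Finite Λ] (N : ℕ) : FiniteDimensional ℝ (polyS Λ E N) :=
  FiniteDimensional.span_of_finite ℝ (finite_range _)

/-- Monomials of degree `k ≤ N` lie in `polyS N`. -/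
theorem smonom_mem {N k : ℕ} (hk : k ≤ N) (κs : Fin k → SiteCoord Λ E) :
    smonom κs ∈ polyS Λ E N :=
  Submodule.subset_span ⟨⟨⟨k, Nat.lt_succ_of_le hk⟩, κs⟩, rfl⟩

/-- `polyS` is monotone in the degree. -/
theorem polyS_mono {N N' : ℕ} (h : N ≤ N') : polyS Λ E N ≤ polyS Λ E N' := by
  refine Submodule.span_le.2 ?_
  rintro _ ⟨⟨k, κs⟩, rfl⟩
  exact smonom_mem ((Nat.lt_succ_iff.1 k.2).trans h) κs

/-- `1 ∈ polyS N`. -/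
theorem one_mem_polyS (N : ℕ) : (fun _ : Λ → E => (1 : ℝ)) ∈ polyS Λ E N := by
  have h := smonom_mem (Λ := Λ) (E := E) (N := N) (Nat.zero_le N)
    (Fin.elim0 : Fin 0 → SiteCoord Λ E)
  rwa [smonom_zero] at h

/-- Constants lie in `polyS N`. -/
theorem const_mem_polyS (N : ℕ) (c : ℝ) : (fun _ : Λ → E => c) ∈ polyS Λ E N := by
  have : (fun _ : Λ → E => c) = c • fun _ : Λ → E => (1 : ℝ) := by
    funext x; simp
  rw [this]
  exact Submodule.smul_mem _ c (one_mem_polyS N)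

/-- Coordinates lie in `polyS N`, `N ≥ 1`. -/
theorem scoord_mem_polyS {N : ℕ} (hN : 1 ≤ N) (κ : SiteCoord Λ E) : scoord κ ∈ polyS Λ E N := by
  have h := smonom_mem (N := N) hN (fun _ : Fin 1 => κ)
  have e : smonom (fun _ : Fin 1 => κ) = scoord κ := by
    funext x; simp [smonom]
  rwa [e] at h

/-- **Every linear site functional `x ↦ ⟪w, x n⟫` lies in `polyS 1`** (expand `w` in the frame). -/
theorem slin_mem_polyS {N : ℕ} (hN : 1 ≤ N) (n : Λ) (w : E) :
    (fun x : Λ → E => ⟪w, x n⟫) ∈ polyS Λ E N := by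
  have h : (fun x : Λ → E => ⟪w, x n⟫) =
      ∑ i, ⟪w, stdOrthonormalBasis ℝ E i⟫ • scoord ((n, i) : SiteCoord Λ E) := by
    funext x
    simp only [Finset.sum_apply, Pi.smul_apply, smul_eq_mul, scoord]
    exact ((stdOrthonormalBasis ℝ E).sum_inner_mul_inner w (x n)).symm
  rw [h]
  exact Submodule.sum_mem _ fun i _ => Submodule.smul_mem _ _ (scoord_mem_polyS hN _)

/-- Products of site monomials are site monomials. -/
theorem smonom_mul_smonom {k k' : ℕ} (κs : Fin k → SiteCoord Λ E) (κs' : Fin k' → SiteCoord Λ E) :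
    smonom κs * smonom κs' = smonom (Fin.append κs κs') := by
  funext x
  simp only [Pi.mul_apply, smonom, Fin.prod_univ_add, Fin.append_left, Fin.append_right]

/-- **`polyS a · polyS b ⊆ polyS (a + b)`**. -/
theorem mul_mem_polyS {a b : ℕ} {f g : (Λ → E) → ℝ} (hf : f ∈ polyS Λ E a)
    (hg : g ∈ polyS Λ E b) : f * g ∈ polyS Λ E (a + b) := by
  induction hf using Submodule.span_induction with
  | mem x hx =>
      obtain ⟨⟨k, κs⟩, rfl⟩ := hx
      induction hg using Submodule.span_induction with
      | mem y hy =>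
          obtain ⟨⟨k', κs'⟩, rfl⟩ := hy
          rw [smonom_mul_smonom]
          exact smonom_mem (Nat.add_le_add (Nat.lt_succ_iff.1 k.2) (Nat.lt_succ_iff.1 k'.2)) _
      | zero => rw [mul_zero]; exact Submodule.zero_mem _
      | add y z _ _ hy hz => rw [mul_add]; exact Submodule.add_mem _ hy hz
      | smul c y _ hy => rw [mul_smul_comm]; exact Submodule.smul_mem _ c hy
  | zero => rw [zero_mul]; exact Submodule.zero_mem _
  | add x y _ _ hx hy => rw [add_mul]; exact Submodule.add_mem _ hx hy
  | smul c x _ hx => rw [smul_mul_assoc]; exact Submodule.smul_mem _ c hx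

/-- Degree-bounded products. -/
theorem mul_mem_polyS_of_le {a b N : ℕ} (h : a + b ≤ N) {f g : (Λ → E) → ℝ}
    (hf : f ∈ polyS Λ E a) (hg : g ∈ polyS Λ E b) : f * g ∈ polyS Λ E N :=
  polyS_mono h (mul_mem_polyS hf hg)

end Spaces

/-! ## §2 Smoothness -/

section Smooth

variable [Fintype Λ]

/-- A site coordinate as a continuous linear functional on `Λ → E`. -/
def scoordCLM (κ : SiteCoord Λ E) : (Λ → E) →L[ℝ] ℝ :=
  (innerSL ℝ (stdOrthonormalBasis ℝ E κ.2)).comp (ContinuousLinearMap.proj κ.1)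

omit [Fintype Λ] in
/-- `scoordCLM κ` is `scoord κ` as a function. -/
theorem coe_scoordCLM (κ : SiteCoord Λ E) : ⇑(scoordCLM κ) = scoord κ := by
  funext x; simp [scoordCLM, scoord]

/-- Site coordinates are smooth. -/
theorem contDiff_scoord (κ : SiteCoord Λ E) : ContDiff ℝ ∞ (scoord κ) := by
  rw [← coe_scoordCLM]; exact (scoordCLM κ).contDiff

/-- Site monomials are smooth. -/
theorem contDiff_smonom {k : ℕ} (κs : Fin k → SiteCoord Λ E) : ContDiff ℝ ∞ (smonom κs) := by
  show ContDiff ℝ ∞ fun x => ∏ j, scoord (κs j) x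
  exact contDiff_prod fun j _ => contDiff_scoord (κs j)

/-- Members of `polyS N` are smooth. -/
theorem contDiff_of_mem_polyS {N : ℕ} {f : (Λ → E) → ℝ} (hf : f ∈ polyS Λ E N) :
    ContDiff ℝ ∞ f := by
  induction hf using Submodule.span_induction with
  | mem x hx =>
      obtain ⟨⟨k, κs⟩, rfl⟩ := hx
      exact contDiff_smonom κs
  | zero => exact contDiff_const
  | add x y _ _ hx hy => exact hx.add hy
  | smul c x _ hx => exact hx.const_smul c

end Smooth

end Summit.Ventures.LatticeQCDFlow.Exactness

end
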